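import Literature.Barriers.ValiantsHypothesis.BDGIL24HighestWeightProjectionProofs

/-!
# van den Berg–Dutta–Gesmundo–Ikenmeyer–Lysikov 2024, Theorem 2.4 (main theorem about algebraic
# natural proofs) — PROVED (`BergEtAl2024.thm_2_4_holds`)

Discharge of the named fact `BergEtAl2024.thm_2_4` of `BDGIL24IsotypicNaturalProofs.lean`
(val-lit row vdBDGIL24-A; M. van den Berg, P. Dutta, F. Gesmundo, C. Ikenmeyer, V. Lysikov,
*Algebraic metacomplexity and representation theory*, arXiv:2411.03444, Thm. 2.4,
[cite: BergEtAl2024, Thm. 2.4, p.10 (PDF p.11)]): for the class `C` cut out by an invariant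
complexity measure `c`, `C` has algebraic natural proofs iff `I(C) ∩ metaVQP ∩ Isotypic` contains
a sequence that is not eventually zero. This is the fact consumed BY NAME in the `BarrierLever`
NP-corpus chain (`Summits/ValiantsHypothesis/…/Theorems/BarrierLeverNPCorpusChainBDGIL.lean`,
`exists_isotypic_equations_of_not_crux`), which thereby becomes unconditional.

## The proof (the printed one, p.10–11, with Thm. 1.1 in its orbit-span form)

"One direction is clear" (`thm_2_4_mpr`, statement file). For the other, let
`Δ ∈ I(C) ∩ metaVQP` be not eventually zero, of format `(δ(n), n, k(n))`.

1. **Replacement** (`exists_hwv_naturalProofs`: natural proofs can be taken to be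
   highest-weight vectors). For each `n` with `Δ_n ≠ 0` the orbit span
   `M_n = span (GL_{k(n)} · Δ_n)` is a
   nonzero finite-dimensional (`exists_finset_forall_coordRep_mem_span`) `GL`-stable subspace of
   the rational representation `k[Sym^n]` (`isRationalRep_coordRep`), so it contains a nonzero
   highest-weight vector `Δ'_n` (`exists_mem_highestWeightSpace_of_stable`,
   `BDGIL24IsotypicProjectionProofs.lean`), which is isotypic (`highestWeightSpace_le_hwSubrep`).
   (The print projects `Δ_n` onto a nonzero isotypic component; any nonzero isotypic element of
   `M_n` does, and a highest-weight vector is the cheapest to name.) `Δ'` is not eventually zero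
   because `Δ` is not.
2. **`Δ' ∈ I(C)`** (`eval_formCoeff_eq_zero_of_mem_span_orbit`): "`I(X)_δ` is a linear subspace …
   closed under the action of `GL_{k(n)}`, since each `X_{n,i}` is invariant" —
   `(g · Δ)(f) = Δ(g⁻¹ · f)` (`aeval_formCoeff_coordSubst`) and the slices of an invariant measure
   are `GL`-stable (`linSubstRep_mem_slice`).
3. **`Δ' ∈ metaVQP`**: same `k(n)`, same degrees `δ(n)` (`isHomogeneous_of_mem_span_orbit`), and
   `cc(Δ'_n) ≤ (δ(n) n + 1)^{k(n)² - 1} (cc(Δ_n) + 2)` (`affComplexity_le_of_mem_span_orbit'`, the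
   orbit-span form of Thm. 1.1 with the SHARP exponent `k² - 1`: the coefficients of the generic
   translate of a homogeneous `Δ` are homogeneous of degree exactly `δ n` in the `k²` matrix
   entries, §`CoeffHomogeneous`, `card_le_pow_of_degree_eq` — needed for the formats with
   `k(n) = 1`, where `N(n) = 1` and the quasi-polynomial budget is a constant), which is
   quasi-polynomial in `N(n) = C(k(n) + n - 1, n)` (`qp_bookkeeping`): "in all applications of
   Theorem 1.1, `k` is logarithmic" (§2.5) — indeed `N ≥ 2^{min(k-1, n)}`
   (`two_pow_min_le_numMonomials`) gives `k ≤ (log₂ N + 2)^{c₁+1}` when `k ≤ n^{c₁} + c₁`, and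
   `n < N` for `k ≥ 2`.

Theorem-only file (no definitions). Honest framing: one discharge of typed literature (net debt
−1) along the printed proof, with Thm. 1.1 entering in the orbit-span form of
`BDGIL24IsotypicProjectionProofs.lean` (disclosed); the statement is the fact name, unchanged.
VP ≠ VNP is NOT proved and nothing here is progress on it: Thm. 2.4 says that natural proofs, IF
they exist, can be taken isotypic.

## References
* [BergEtAl2024] M. van den Berg, P. Dutta, F. Gesmundo, C. Ikenmeyer, V. Lysikov,
  arXiv:2411.03444 (2024): §2.5 (Def. 2.3, `metaVQP`, "k is logarithmic"), Thm. 2.4 and its proof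
  (p.10–11). Held text `paper:arxiv-2411.03444`, p0010–p0012.
* [GoodmanWallachGTM255] R. Goodman, N. Wallach, *Symmetry, Representations, and Invariants*,
  Cor. 3.2.3 (highest-weight vectors), Thm. 3.3.11 (complete reducibility).

## Mathlib and tree
Mathlib: `Nat.log` (`Nat.le_log_of_pow_le`, `Nat.lt_pow_succ_log_self`), `Nat.choose`
(`choose_succ_succ'`, `choose_symm_add`, `choose_le_choose`, `choose_succ_self_right`),
`MvPolynomial.IsHomogeneous` (`.mul`, `.sum`, `degree_eq_sum_deg_support`),
`Fintype.card_subtype_compl`, `Submodule.span_induction`.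
Tree: `BDGIL24IsotypicProjectionProofs` (`exists_mem_highestWeightSpace_of_stable`,
`exists_finset_forall_coordRep_mem_span`, `coordRep_eq_map_eval_genericSubst`,
`affComplexity_le_card_mul_of_mem_span`, `affComplexity_le_of_mem_range_orbit`,
`span_orbit_le_comap`, `self_mem_span_orbit`), `BDGIL24HighestWeightProjectionProofs`
(`isHomogeneous_of_mem_span_orbit`), `BDGIL24IsotypicNaturalProofs` (`thm_2_4`, `thm_2_4_mpr`,
`slice`, `vanishingIdealSeq`, `metaVQP`, `IsQPBoundedIn`, `numMonomials`, `IsIsotypic`,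
`highestWeightSpace_le_hwSubrep`, `IsInvariantMeasure`), `OrbitCoordinateRing`
(`aeval_formCoeff_coordSubst`), `LinSubst` (`linSubstRep_apply`, `linSubst_isHomogeneous`),
`CoordRepRational` (`isRationalRep_coordRep`), `GKSS17NaturalProofsPIT` (`GKSS2017.IsPBoundedIn`),
`ValiantClasses` (`IsPBounded`).
-/

noncomputable section

open MvPolynomial
open scoped BigOperators

namespace Literature.Barriers.ValiantsHypothesis

namespace BergEtAl2024

open Literature.Computability.AlgebraicComplexity Literature.NumberTheory.DiophantineGeometry

/-! ### Exact degrees of the coefficients of the generic translate -/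

section CoeffHomogeneous

variable {k : Type*} [CommSemiring k] {τ ι ι' : Type*}

/-- Constants: the coefficients of `C c` are `c` or `0`.
[cite: BergEtAl2024, Thm. 2.4 (proof, elementary step of this route), p.10 (PDF p.11)] -/
theorem isHomogeneous_coeff_C {c : MvPolynomial τ k} {D : ℕ} (hc : c.IsHomogeneous D)
    (u : ι →₀ ℕ) : (coeff u (C c : MvPolynomial ι (MvPolynomial τ k))).IsHomogeneous D := by
  classical
  rw [coeff_C]
  split_ifs
  · exact hc
  · exact isHomogeneous_zero _ _ _

/-- Variables: the coefficients of `X e` are `1` or `0`.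
[cite: BergEtAl2024, Thm. 2.4 (proof, elementary step of this route), p.10 (PDF p.11)] -/
theorem isHomogeneous_coeff_X (e : ι) (u : ι →₀ ℕ) :
    (coeff u (X e : MvPolynomial ι (MvPolynomial τ k))).IsHomogeneous 0 := by
  classical
  rw [coeff_X]
  split_ifs
  · exact isHomogeneous_one _ _
  · exact isHomogeneous_zero _ _ _

/-- Sums. [cite: BergEtAl2024, Thm. 2.4 (proof, elementary step of this route), p.10 (PDF p.11)] -/
theorem isHomogeneous_coeff_sum {α : Type*} (s : Finset α)
    {f : α → MvPolynomial ι (MvPolynomial τ k)} {D : ℕ}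
    (hf : ∀ a ∈ s, ∀ u, (coeff u (f a)).IsHomogeneous D) (u : ι →₀ ℕ) :
    (coeff u (∑ a ∈ s, f a)).IsHomogeneous D := by
  classical
  rw [coeff_sum]
  exact IsHomogeneous.sum _ _ _ fun a ha => hf a ha u

/-- Products: coefficient degrees add.
[cite: BergEtAl2024, Thm. 2.4 (proof, elementary step of this route), p.10 (PDF p.11)] -/
theorem isHomogeneous_coeff_mul {P Q : MvPolynomial ι (MvPolynomial τ k)} {D₁ D₂ : ℕ}
    (hP : ∀ u, (coeff u P).IsHomogeneous D₁) (hQ : ∀ u, (coeff u Q).IsHomogeneous D₂)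
    (u : ι →₀ ℕ) : (coeff u (P * Q)).IsHomogeneous (D₁ + D₂) := by
  classical
  rw [coeff_mul]
  exact IsHomogeneous.sum _ _ _ fun x _ => (hP x.1).mul (hQ x.2)

/-- Finite products.
[cite: BergEtAl2024, Thm. 2.4 (proof, elementary step of this route), p.10 (PDF p.11)] -/
theorem isHomogeneous_coeff_finsetProd {α : Type*} (s : Finset α)
    (f : α → MvPolynomial ι (MvPolynomial τ k)) (D : α → ℕ)
    (hf : ∀ a ∈ s, ∀ u, (coeff u (f a)).IsHomogeneous (D a)) (u : ι →₀ ℕ) :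
    (coeff u (∏ a ∈ s, f a)).IsHomogeneous (∑ a ∈ s, D a) := by
  classical
  induction s using Finset.induction_on generalizing u with
  | empty =>
    rw [Finset.prod_empty, Finset.sum_empty, coeff_one]
    split_ifs
    · exact isHomogeneous_one _ _
    · exact isHomogeneous_zero _ _ _
  | insert a s ha ih =>
    rw [Finset.prod_insert ha, Finset.sum_insert ha]
    exact isHomogeneous_coeff_mul (hf a (Finset.mem_insert_self a s))
      (fun u => ih (fun b hb => hf b (Finset.mem_insert_of_mem hb)) u) u

/-- Powers.
[cite: BergEtAl2024, Thm. 2.4 (proof, elementary step of this route), p.10 (PDF p.11)] -/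
theorem isHomogeneous_coeff_pow {P : MvPolynomial ι (MvPolynomial τ k)} {D : ℕ}
    (hP : ∀ u, (coeff u P).IsHomogeneous D) (n : ℕ) (u : ι →₀ ℕ) :
    (coeff u (P ^ n)).IsHomogeneous (n * D) := by
  classical
  have h := isHomogeneous_coeff_finsetProd (Finset.range n) (fun _ => P) (fun _ => D)
    (fun _ _ => hP) u
  rwa [Finset.prod_const, Finset.card_range, Finset.sum_const, Finset.card_range,
    smul_eq_mul] at h

/-- Substitution: if `F` is homogeneous of degree `δ` and every coefficient of every `L i` is
homogeneous of degree `m`, then every coefficient of `F(L)` is homogeneous of degree `δ m`.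
[cite: BergEtAl2024, Thm. 2.4 (proof, elementary step of this route), p.10 (PDF p.11)] -/
theorem isHomogeneous_coeff_aeval (F : MvPolynomial ι' k) {δ : ℕ} (hF : F.IsHomogeneous δ)
    (L : ι' → MvPolynomial ι (MvPolynomial τ k)) {m : ℕ}
    (hL : ∀ i u, (coeff u (L i)).IsHomogeneous m) (u : ι →₀ ℕ) :
    (coeff u (aeval L F)).IsHomogeneous (δ * m) := by
  classical
  have hsum : aeval L F = ∑ s ∈ F.support, aeval L (monomial s (coeff s F)) := by
    conv_lhs => rw [F.as_sum]
    rw [map_sum]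
  rw [hsum]
  refine isHomogeneous_coeff_sum _ (fun s hs u => ?_) u
  rw [aeval_monomial]
  have hdeg : ∑ i ∈ s.support, s i = δ := (hF.degree_eq_sum_deg_support hs).symm
  have hC : ∀ u, (coeff u (algebraMap k (MvPolynomial ι (MvPolynomial τ k))
      (coeff s F))).IsHomogeneous 0 := fun u => by
    rw [IsScalarTower.algebraMap_apply k (MvPolynomial τ k) (MvPolynomial ι (MvPolynomial τ k)),
      MvPolynomial.algebraMap_eq, MvPolynomial.algebraMap_eq]
    exact isHomogeneous_coeff_C (isHomogeneous_C _ _) u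
  have hprod : ∀ u, (coeff u (s.prod fun i e => L i ^ e)).IsHomogeneous (δ * m) := fun u => by
    rw [Finsupp.prod, ← hdeg, Finset.sum_mul]
    exact isHomogeneous_coeff_finsetProd s.support _ _
      (fun i _ u => isHomogeneous_coeff_pow (hL i) (s i) u) u
  have h := isHomogeneous_coeff_mul hC hprod u
  rwa [zero_add] at h

end CoeffHomogeneous

/-! ### The orbit span of a homogeneous polynomial function: the sharp count -/

section SpanBoundHom

variable {σ : Type*} [Fintype σ] [LinearOrder σ] {k : Type*} [Field k]

/-- The entries of the generic substitution matrix are homogeneous of degree `m = |e|` in the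
matrix entries.
[cite: BergEtAl2024, Thm. 2.4 (proof, elementary step of this route), p.10 (PDF p.11)] -/
theorem isHomogeneous_coeff_linSubst_mvPolynomialX_monomial {m : ℕ} (e : DegIdx σ m)
    (c : σ →₀ ℕ) :
    (coeff c (linSubst σ (MvPolynomial (σ × σ) k) (Matrix.mvPolynomialX σ σ k)
      (monomial e.1 1))).IsHomogeneous m := by
  classical
  have hL : ∀ (i : σ) (u : σ →₀ ℕ), (coeff u (∑ j, Matrix.mvPolynomialX σ σ k j i •
      (X j : MvPolynomial σ (MvPolynomial (σ × σ) k)))).IsHomogeneous 1 := by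
    intro i u
    refine isHomogeneous_coeff_sum _ (fun j _ u => ?_) u
    rw [smul_eq_C_mul]
    have hc : (Matrix.mvPolynomialX σ σ k j i).IsHomogeneous 1 := by
      rw [Matrix.mvPolynomialX_apply]
      exact isHomogeneous_X k _
    have h := isHomogeneous_coeff_mul (isHomogeneous_coeff_C (ι := σ) hc)
      (isHomogeneous_coeff_X (τ := σ × σ) (k := k) j) u
    simpa using h
  have h1 : linSubst σ (MvPolynomial (σ × σ) k) (Matrix.mvPolynomialX σ σ k) (monomial e.1 1) =
      aeval (fun i : σ => ∑ j, Matrix.mvPolynomialX σ σ k j i •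
        (X j : MvPolynomial σ (MvPolynomial (σ × σ) k))) (monomial e.1 (1 : k)) := by
    simp only [linSubst, aeval_monomial, map_one, one_mul]
  rw [h1]
  have hdeg : (monomial e.1 (1 : k) : MvPolynomial σ k).IsHomogeneous m := by
    exact isHomogeneous_monomial _ (mem_degMonomials_iff.mp e.2)
  have h := isHomogeneous_coeff_aeval (monomial e.1 (1 : k)) hdeg _ hL c
  simpa using h

/-- **The coefficients of the generic translate of a homogeneous `F` of degree `δ` (format
`(δ, m, ·)`) are homogeneous of degree exactly `δ m` in the matrix entries.**
[cite: BergEtAl2024, Thm. 2.4 (proof, elementary step of this route), p.10 (PDF p.11)] -/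
theorem isHomogeneous_coeff_genericSubst {m δ : ℕ} (F : MvPolynomial (DegIdx σ m) k)
    (hF : F.IsHomogeneous δ) (u : DegIdx σ m →₀ ℕ) :
    (coeff u (aeval (fun d : DegIdx σ m => ∑ e : DegIdx σ m,
        C (coeff d.1 (linSubst σ (MvPolynomial (σ × σ) k) (Matrix.mvPolynomialX σ σ k)
          (monomial e.1 1))) * X e) F)).IsHomogeneous (δ * m) := by
  classical
  refine isHomogeneous_coeff_aeval F hF _ (fun d u => ?_) u
  refine isHomogeneous_coeff_sum _ (fun e _ u => ?_) u
  have h := isHomogeneous_coeff_mul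
    (isHomogeneous_coeff_C (ι := DegIdx σ m)
      (isHomogeneous_coeff_linSubst_mvPolynomialX_monomial (k := k) e d.1))
    (isHomogeneous_coeff_X (τ := σ × σ) (k := k) e) u
  simpa using h

/-- Counting exponent vectors of a fixed degree: a finite set of `n : α →₀ ℕ` of degree `D` has at
most `(D + 1)^{|α| - 1}` elements (all coordinates but one determine the last).
[cite: BergEtAl2024, Thm. 2.4 (proof, elementary step of this route), p.10 (PDF p.11)] -/
theorem card_le_pow_of_degree_eq {α : Type*} [Fintype α] [DecidableEq α] (D : ℕ)
    (S : Finset (α →₀ ℕ)) (hS : ∀ n ∈ S, n.degree = D) :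
    S.card ≤ (D + 1) ^ (Fintype.card α - 1) := by
  classical
  rcases isEmpty_or_nonempty α with hα | ⟨⟨a₀⟩⟩
  · have h1 : S.card ≤ 1 := Finset.card_le_one.mpr fun n _ n' _ => Subsingleton.elim n n'
    simpa [Fintype.card_eq_zero] using h1
  · have hle : ∀ n ∈ S, ∀ a, n a ≤ D := fun n hn a => (Finsupp.le_degree a n).trans (hS n hn).le
    let φ : (α →₀ ℕ) → ({a : α // ¬ a = a₀} → Fin (D + 1)) :=
      fun n a => ⟨min (n a.1) D, by omega⟩
    have hinj : Set.InjOn φ (S : Set (α →₀ ℕ)) := by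
      intro n hn n' hn' h
      have hrest : ∀ a, ¬ a = a₀ → n a = n' a := by
        intro a ha
        have h1 := congr_fun h ⟨a, ha⟩
        simp only [φ, Fin.mk.injEq] at h1
        rwa [min_eq_left (hle n hn a), min_eq_left (hle n' hn' a)] at h1
      have hsum : ∀ n'' : α →₀ ℕ, n''.degree = n'' a₀ + ∑ a ∈ Finset.univ.erase a₀, n'' a := by
        intro n''
        rw [Finsupp.degree_eq_sum, ← Finset.add_sum_erase _ _ (Finset.mem_univ a₀)]
      have h0 : n a₀ = n' a₀ := by
        have e1 := hsum n
        have e2 := hsum n'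
        rw [hS n hn] at e1
        rw [hS n' hn'] at e2
        have e3 : ∑ a ∈ Finset.univ.erase a₀, n a = ∑ a ∈ Finset.univ.erase a₀, n' a :=
          Finset.sum_congr rfl fun a ha => hrest a (Finset.ne_of_mem_erase ha)
        omega
      ext a
      by_cases ha : a = a₀
      · rw [ha]; exact h0
      · exact hrest a ha
    calc S.card ≤ (Finset.univ : Finset ({a : α // ¬ a = a₀} → Fin (D + 1))).card :=
          Finset.card_le_card_of_injOn φ (fun n _ => Finset.mem_coe.mpr (Finset.mem_univ _)) hinj
      _ = (D + 1) ^ (Fintype.card α - 1) := by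
          rw [Finset.card_univ, Fintype.card_fun, Fintype.card_fin, Fintype.card_subtype_compl,
            Fintype.card_subtype_eq]

/-- **Sharp orbit-span count.** For `F` homogeneous of degree `δ` on `Sym^m(k^n)`, every
translate `g · F` lies in the span of at most `(δ m + 1)^{n² - 1}` fixed vectors (the
coefficient vectors of the generic translate, indexed by the monomials of degree exactly `δ m` in
the `n²` matrix entries). For `n = 1` this is the line `k F`.
[cite: BergEtAl2024, Thm. 2.4 (proof: "stays in metaVQP by Thm. 1.1"), p.10 (PDF p.11)] -/
theorem exists_finset_forall_coordRep_mem_span_of_isHomogeneous {m δ : ℕ}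
    (F : MvPolynomial (DegIdx σ m) k) (hF : F.IsHomogeneous δ) :
    ∃ T : Finset (MvPolynomial (DegIdx σ m) k),
      T.card ≤ (δ * m + 1) ^ (Fintype.card σ * Fintype.card σ - 1) ∧
      ∀ g : GL σ k, coordRep σ k m g F ∈
        Submodule.span k (T : Set (MvPolynomial (DegIdx σ m) k)) := by
  classical
  set G : MvPolynomial (DegIdx σ m) (MvPolynomial (σ × σ) k) :=
    aeval (fun d : DegIdx σ m => ∑ e : DegIdx σ m,
      C (coeff d.1 (linSubst σ (MvPolynomial (σ × σ) k) (Matrix.mvPolynomialX σ σ k)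
        (monomial e.1 1))) * X e) F with hG
  set S : Finset (σ × σ →₀ ℕ) := G.support.biUnion fun u => (coeff u G).support with hS
  let v : (σ × σ →₀ ℕ) → MvPolynomial (DegIdx σ m) k :=
    fun n => ∑ u ∈ G.support, coeff n (coeff u G) • (monomial u (1 : k))
  have hSdeg : ∀ n ∈ S, n.degree = δ * m := by
    intro n hn
    obtain ⟨u, -, hnu⟩ := Finset.mem_biUnion.mp hn
    have h := isHomogeneous_coeff_genericSubst F hF u (mem_support_iff.mp hnu)
    rw [Finsupp.degree_eq_weight_one]
    exact h
  refine ⟨S.image v, Finset.card_image_le.trans ?_, fun g => ?_⟩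
  · have h := card_le_pow_of_degree_eq (δ * m) S hSdeg
    rwa [Fintype.card_prod] at h
  · rw [coordRep_eq_map_eval_genericSubst, ← hG]
    set a : σ × σ → k := fun ij => ((g⁻¹ : GL σ k) : Matrix σ σ k) ij.1 ij.2 with ha
    have h1 : MvPolynomial.map (eval a) G =
        ∑ u ∈ G.support, (eval a (coeff u G)) •
          (monomial u (1 : k) : MvPolynomial (DegIdx σ m) k) := by
      conv_lhs => rw [G.as_sum, map_sum]
      refine Finset.sum_congr rfl fun u _ => ?_
      rw [map_monomial, smul_monomial, smul_eq_mul, mul_one]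
    have h2 : ∀ u ∈ G.support,
        eval a (coeff u G) = ∑ n ∈ S, coeff n (coeff u G) * ∏ ij, a ij ^ n ij := by
      intro u hu
      rw [eval_eq']
      refine Finset.sum_subset (Finset.subset_biUnion_of_mem (fun u => (coeff u G).support) hu) ?_
      intro n _ hn
      rw [notMem_support_iff.mp hn, zero_mul]
    have hexp : MvPolynomial.map (eval a) G = ∑ n ∈ S, (∏ ij, a ij ^ n ij) • v n := by
      rw [h1]
      calc ∑ u ∈ G.support, eval a (coeff u G) •
            (monomial u (1 : k) : MvPolynomial (DegIdx σ m) k)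
          = ∑ u ∈ G.support, ∑ n ∈ S, (coeff n (coeff u G) * ∏ ij, a ij ^ n ij) •
              (monomial u (1 : k) : MvPolynomial (DegIdx σ m) k) := by
            refine Finset.sum_congr rfl fun u hu => ?_
            rw [h2 u hu, Finset.sum_smul]
        _ = ∑ n ∈ S, ∑ u ∈ G.support, (coeff n (coeff u G) * ∏ ij, a ij ^ n ij) •
              (monomial u (1 : k) : MvPolynomial (DegIdx σ m) k) := Finset.sum_comm
        _ = ∑ n ∈ S, (∏ ij, a ij ^ n ij) • v n := by
            refine Finset.sum_congr rfl fun n _ => ?_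
            simp only [v, Finset.smul_sum, smul_smul, mul_comm]
    rw [hexp]
    refine Submodule.sum_mem _ fun n hn => Submodule.smul_mem _ _ (Submodule.subset_span ?_)
    exact Finset.mem_coe.mpr (Finset.mem_image_of_mem v hn)

/-- Dimension form of the sharp count: `dim span (GL · F) ≤ (δ m + 1)^{n² - 1}` for `F`
homogeneous of degree `δ`. [cite: BergEtAl2024, Thm. 2.4 (proof), p.10 (PDF p.11)] -/
theorem finrank_span_orbit_coordRep_le_of_isHomogeneous {m δ : ℕ}
    (F : MvPolynomial (DegIdx σ m) k) (hF : F.IsHomogeneous δ) :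
    Module.finrank k (Submodule.span k (Set.range fun g : GL σ k => coordRep σ k m g F)) ≤
      (δ * m + 1) ^ (Fintype.card σ * Fintype.card σ - 1) := by
  obtain ⟨T, hT, hmem⟩ := exists_finset_forall_coordRep_mem_span_of_isHomogeneous F hF
  have hle : Submodule.span k (Set.range fun g : GL σ k => coordRep σ k m g F) ≤
      Submodule.span k (T : Set (MvPolynomial (DegIdx σ m) k)) :=
    Submodule.span_le.mpr (by rintro _ ⟨g, rfl⟩; exact hmem g)
  exact (Submodule.finrank_mono hle).trans ((finrank_span_finset_le_card T).trans hT)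

end SpanBoundHom

/-- **`cc` on the orbit span, sharp exponent**: for `Δ` of format `(δ, d, k)` with `cc(Δ) ≤ s`,
every element of `span (GL_k · Δ)` has `cc ≤ (δd + 1)^{k² - 1} (s + 2)`.
[cite: BergEtAl2024, Thm. 2.4 (proof: "stays in metaVQP by Thm. 1.1"), p.10 (PDF p.11)] -/
theorem affComplexity_le_of_mem_span_orbit' {k d δ s : ℕ} {Δ : MvPolynomial (DegIdx (Fin k) d) ℂ}
    (hΔ : Δ.IsHomogeneous δ) (hs : affComplexity Δ ≤ s) {w : MvPolynomial (DegIdx (Fin k) d) ℂ}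
    (hw : w ∈ Submodule.span ℂ (Set.range fun h : GL (Fin k) ℂ => coordRep (Fin k) ℂ d h Δ)) :
    affComplexity w ≤ (δ * d + 1) ^ (k * k - 1) * (s + 2) := by
  obtain ⟨T, hT, hmem⟩ := exists_finset_forall_coordRep_mem_span_of_isHomogeneous Δ hΔ
  have hsub : Set.range (fun h : GL (Fin k) ℂ => coordRep (Fin k) ℂ d h Δ) ⊆
      Submodule.span ℂ (T : Set (MvPolynomial (DegIdx (Fin k) d) ℂ)) := by
    rintro _ ⟨g, rfl⟩
    exact hmem g
  refine (affComplexity_le_card_mul_of_mem_span (affComplexity_le_of_mem_range_orbit hs) T hsub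
    hw).trans ?_
  rw [Fintype.card_fin] at hT
  exact Nat.mul_le_mul_right _ hT

/-! ### The orbit span of an equation is made of equations (invariance of the slices) -/

section Slices

/-- The slices `X_{d,r}` of an invariant complexity measure are `GL_k`-stable ("each `X_{n,i}`
is invariant under the action of `GL_{k(n)}`", proof of Thm. 2.4).
[cite: BergEtAl2024, Thm. 2.4 (proof), p.10 (PDF p.11)] -/
theorem linSubstRep_mem_slice {c : (k d : ℕ) → MvPolynomial (Fin k) ℂ → ℕ}
    (hc : IsInvariantMeasure c) {k d r : ℕ} {f : MvPolynomial (Fin k) ℂ}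
    (hf : f ∈ slice c k d r) (g : GL (Fin k) ℂ) : linSubstRep (Fin k) ℂ g f ∈ slice c k d r := by
  obtain ⟨hhom, hcf⟩ := hf
  refine ⟨?_, ?_⟩
  · rw [linSubstRep_apply]
    exact linSubst_isHomogeneous _ hhom
  · rw [hc k d g f hhom]
    exact hcf

/-- **Translates of an equation are equations**: if `Δ` vanishes on the slice `X_{d,r}` then so
does every element of `span (GL_k · Δ)` (`(g · Δ)(f) = Δ(g⁻¹ · f)` and `X_{d,r}` is stable), so
"`I(X)_δ` is closed under the action of `GL_{k(n)}`".
[cite: BergEtAl2024, Thm. 2.4 (proof), p.10 (PDF p.11)] -/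
theorem eval_formCoeff_eq_zero_of_mem_span_orbit {c : (k d : ℕ) → MvPolynomial (Fin k) ℂ → ℕ}
    (hc : IsInvariantMeasure c) {k d r : ℕ} {Δ : MvPolynomial (DegIdx (Fin k) d) ℂ}
    (hΔ : ∀ f ∈ slice c k d r, eval (formCoeff d f) Δ = 0)
    {w : MvPolynomial (DegIdx (Fin k) d) ℂ}
    (hw : w ∈ Submodule.span ℂ (Set.range fun h : GL (Fin k) ℂ => coordRep (Fin k) ℂ d h Δ))
    {f : MvPolynomial (Fin k) ℂ} (hf : f ∈ slice c k d r) : eval (formCoeff d f) w = 0 := by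
  induction hw using Submodule.span_induction with
  | mem z hz =>
    obtain ⟨g, rfl⟩ := hz
    have h : eval (formCoeff d f) (coordRep (Fin k) ℂ d g Δ) =
        eval (formCoeff d (linSubstRep (Fin k) ℂ g⁻¹ f)) Δ :=
      aeval_formCoeff_coordSubst d g f Δ
    change eval (formCoeff d f) (coordRep (Fin k) ℂ d g Δ) = 0
    rw [h]
    exact hΔ _ (linSubstRep_mem_slice hc hf g⁻¹)
  | zero => exact map_zero _
  | add x y _ _ hx hy => rw [map_add, hx, hy, add_zero]
  | smul a x _ hx => rw [smul_eq_C_mul, map_mul, hx, mul_zero]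

end Slices

/-! ### Quasi-polynomial bookkeeping ("`k` is logarithmic in `N`", §2.5) -/

section QPBookkeeping

/-- `2^b ≤ C(a+b, b)` for `b ≤ a`.
[cite: BergEtAl2024, §2.5 ("k is logarithmic in N"), p.9 (PDF p.10)] -/
theorem two_pow_le_choose_add {a b : ℕ} (h : b ≤ a) : 2 ^ b ≤ (a + b).choose b := by
  induction b generalizing a with
  | zero => simp
  | succ b ih =>
    have h1 : a + (b + 1) = (a + b) + 1 := by ring
    rw [h1, Nat.choose_succ_succ', pow_succ]
    have ih1 : 2 ^ b ≤ (a + b).choose b := ih (by omega)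
    have ih2 : 2 ^ b ≤ (a + b).choose (b + 1) := by
      obtain ⟨a', rfl⟩ : ∃ a', a = a' + 1 := ⟨a - 1, by omega⟩
      have h2 : a' + 1 + b = (a' + b) + 1 := by ring
      rw [h2, Nat.choose_succ_succ']
      exact (ih (by omega)).trans (Nat.le_add_right _ _)
    omega

/-- `2^{min(k-1, n)} ≤ N = C(k + n - 1, n)` (the number of degree-`n` monomials in `k ≥ 1`
variables), so `min(k-1, n) ≤ log₂ N`.
[cite: BergEtAl2024, §2.5 ("k is logarithmic in N"), p.9 (PDF p.10)] -/
theorem two_pow_min_le_numMonomials {k n : ℕ} (hk : 1 ≤ k) :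
    2 ^ min (k - 1) n ≤ (k + n - 1).choose n := by
  rcases le_total n (k - 1) with h | h
  · rw [min_eq_right h]
    have e : k + n - 1 = (k - 1) + n := by omega
    rw [e]
    exact two_pow_le_choose_add h
  · rw [min_eq_left h]
    have e : k + n - 1 = n + (k - 1) := by omega
    rw [e, Nat.choose_symm_add]
    exact two_pow_le_choose_add h

/-- `n + 1 ≤ N = C(k + n - 1, n)` for `k ≥ 2`. [cite: BergEtAl2024, §2.5, p.9 (PDF p.10)] -/
theorem succ_le_numMonomials {k n : ℕ} (hk : 2 ≤ k) : n + 1 ≤ (k + n - 1).choose n := by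
  calc n + 1 = (n + 1).choose n := (Nat.choose_succ_self_right n).symm
    _ ≤ (k + n - 1).choose n := Nat.choose_le_choose n (by omega)

/-- `(L + a)^a ≤ (L + 2)^{a + a²}`. [cite: BergEtAl2024, §2.5, p.9 (PDF p.10)] -/
theorem pow_log_add_le (L a : ℕ) : (L + a) ^ a ≤ (L + 2) ^ (a + a * a) := by
  have h1 : L + a ≤ (L + 2) * (a + 1) := by nlinarith
  have h2 : a + 1 ≤ (L + 2) ^ a :=
    (Nat.lt_two_pow_self).trans_le (Nat.pow_le_pow_left (by omega) a)
  calc (L + a) ^ a ≤ ((L + 2) * (a + 1)) ^ a := Nat.pow_le_pow_left h1 a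
    _ = (L + 2) ^ a * (a + 1) ^ a := mul_pow _ _ _
    _ ≤ (L + 2) ^ a * ((L + 2) ^ a) ^ a := Nat.mul_le_mul_left _ (Nat.pow_le_pow_left h2 a)
    _ = (L + 2) ^ (a + a * a) := by rw [← pow_mul, ← pow_add]

/-- `x + c ≤ x · 2^c` for `x ≥ 1`. [cite: BergEtAl2024, §2.5, p.9 (PDF p.10)] -/
theorem add_le_mul_two_pow {x c : ℕ} (hx : 1 ≤ x) : x + c ≤ x * 2 ^ c := by
  have h1 : c + 1 ≤ 2 ^ c := Nat.lt_two_pow_self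
  nlinarith

/-- **The bookkeeping of the proof of Thm. 2.4.** With `N = C(k + n - 1, n)`: if
`k ≤ n^{c₁} + c₁`, `δ ≤ N^{c₂} + c₂` and `s ≤ 2^{(log₂ N + a)^a}`, then
`(δ n + 1)^{k² - 1} (s + 2) ≤ 2^{(log₂ N + A)^A}` for a constant `A = A(c₁, c₂, a)` — because
`N ≥ 2^{min(k-1, n)}` forces `k ≤ (log₂ N + 2)^{c₁ + 1}` ("`k` is logarithmic in `N`") and, for
`k ≥ 2`, `n < N`.
("In all applications of Theorem 1.1, k is logarithmic", §2.5.)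
[cite: BergEtAl2024, §2.5 and Thm. 2.4 (proof), p.9–10 (PDF p.10–11)] -/
theorem qp_bookkeeping (c₁ c₂ a : ℕ) : ∃ A : ℕ, ∀ (k n δ s B : ℕ),
    k ≤ n ^ c₁ + c₁ → δ ≤ ((k + n - 1).choose n) ^ c₂ + c₂ →
    s ≤ 2 ^ ((Nat.log 2 ((k + n - 1).choose n) + a) ^ a) →
    B ≤ (δ * n + 1) ^ (k * k - 1) * (s + 2) →
    B ≤ 2 ^ ((Nat.log 2 ((k + n - 1).choose n) + A) ^ A) := by
  refine ⟨2 * c₁ + c₂ + 4 + a + a * a + 2, fun k n δ s B hk hδ hs hB => ?_⟩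
  set P : ℕ := 2 * c₁ + c₂ + 4 + a + a * a with hP
  set N := (k + n - 1).choose n with hN
  set L := Nat.log 2 N with hL
  have hM2 : 2 ≤ L + 2 := by omega
  have hM1 : 1 ≤ L + 2 := by omega
  -- (1) the cost of the original metapolynomial
  have hs2 : s + 2 ≤ 2 ^ ((L + 2) ^ (a + a * a) + (L + 2)) := by
    have h1 : (L + a) ^ a ≤ (L + 2) ^ (a + a * a) := pow_log_add_le L a
    calc s + 2 ≤ 2 ^ ((L + a) ^ a) + 2 := by omega
      _ ≤ 2 ^ ((L + a) ^ a + 2) := by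
          rw [pow_add]
          have := Nat.one_le_two_pow (n := (L + a) ^ a)
          omega
      _ ≤ 2 ^ ((L + 2) ^ (a + a * a) + (L + 2)) := Nat.pow_le_pow_right (by norm_num) (by omega)
  -- (2) the orbit factor
  have hfac : (δ * n + 1) ^ (k * k - 1) ≤ 2 ^ ((c₂ + 1) * (L + 2) ^ (2 * c₁ + 3)) := by
    rcases Nat.lt_or_ge k 2 with hk2 | hk2
    · have h0 : k * k - 1 = 0 := by interval_cases k <;> rfl
      rw [h0, pow_zero]
      exact Nat.one_le_two_pow
    · have hNn : n + 1 ≤ N := succ_le_numMonomials hk2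
      have hNlt : N < 2 ^ (L + 1) := Nat.lt_pow_succ_log_self Nat.one_lt_two N
      have hn : n ≤ 2 ^ (L + 1) := by omega
      -- `k` is logarithmic in `N`
      have hkM : k ≤ (L + 2) ^ (c₁ + 1) := by
        have hmin : min (k - 1) n ≤ L :=
          Nat.le_log_of_pow_le Nat.one_lt_two (two_pow_min_le_numMonomials (by omega))
        rcases le_total (k - 1) n with hkn | hkn
        · rw [min_eq_left hkn] at hmin
          calc k ≤ L + 2 := by omega
            _ = (L + 2) ^ 1 := (pow_one _).symm
            _ ≤ (L + 2) ^ (c₁ + 1) := Nat.pow_le_pow_right hM1 (by omega)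
        · rw [min_eq_right hkn] at hmin
          calc k ≤ n ^ c₁ + c₁ := hk
            _ ≤ L ^ c₁ + c₁ := Nat.add_le_add_right (Nat.pow_le_pow_left hmin _) _
            _ ≤ (L + 2) ^ c₁ + (L + 2) ^ c₁ :=
                Nat.add_le_add (Nat.pow_le_pow_left (by omega) _)
                  ((Nat.lt_two_pow_self).le.trans (Nat.pow_le_pow_left hM2 c₁))
            _ = 2 * (L + 2) ^ c₁ := by ring
            _ ≤ (L + 2) * (L + 2) ^ c₁ := Nat.mul_le_mul_right _ hM2
            _ = (L + 2) ^ (c₁ + 1) := by ring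
      -- `δ n + 1 ≤ 2^{(L+2)(c₂+1)}`
      have hδ' : δ ≤ 2 ^ ((L + 1) * c₂ + c₂) := by
        calc δ ≤ N ^ c₂ + c₂ := hδ
          _ ≤ (2 ^ (L + 1)) ^ c₂ + c₂ := Nat.add_le_add_right (Nat.pow_le_pow_left hNlt.le _) _
          _ = 2 ^ ((L + 1) * c₂) + c₂ := by rw [← pow_mul]
          _ ≤ 2 ^ ((L + 1) * c₂) * 2 ^ c₂ := add_le_mul_two_pow Nat.one_le_two_pow
          _ = 2 ^ ((L + 1) * c₂ + c₂) := by rw [← pow_add]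
      have hδn : δ * n + 1 ≤ 2 ^ ((L + 2) * (c₂ + 1)) := by
        have h1 : 1 ≤ 2 ^ ((L + 1) * c₂ + c₂) * 2 ^ (L + 1) :=
          Nat.mul_le_mul Nat.one_le_two_pow Nat.one_le_two_pow
        have e : (L + 1) * c₂ + c₂ + (L + 1) + 1 = (L + 2) * (c₂ + 1) := by ring
        calc δ * n + 1 ≤ 2 ^ ((L + 1) * c₂ + c₂) * 2 ^ (L + 1) + 1 :=
              Nat.add_le_add_right (Nat.mul_le_mul hδ' hn) 1
          _ ≤ 2 ^ ((L + 1) * c₂ + c₂) * 2 ^ (L + 1) * 2 := by omega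
          _ = 2 ^ ((L + 1) * c₂ + c₂ + (L + 1) + 1) := by ring
          _ = 2 ^ ((L + 2) * (c₂ + 1)) := by rw [e]
      have hkk : k * k ≤ (L + 2) ^ (2 * c₁ + 2) := by
        calc k * k ≤ (L + 2) ^ (c₁ + 1) * (L + 2) ^ (c₁ + 1) := Nat.mul_le_mul hkM hkM
          _ = (L + 2) ^ (2 * c₁ + 2) := by rw [← pow_add]; ring_nf
      have hexp : (L + 2) * (c₂ + 1) * (k * k) ≤ (c₂ + 1) * (L + 2) ^ (2 * c₁ + 3) := by
        calc (L + 2) * (c₂ + 1) * (k * k) ≤ (L + 2) * (c₂ + 1) * (L + 2) ^ (2 * c₁ + 2) :=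
              Nat.mul_le_mul_left _ hkk
          _ = (c₂ + 1) * (L + 2) ^ (2 * c₁ + 3) := by ring
      calc (δ * n + 1) ^ (k * k - 1) ≤ (δ * n + 1) ^ (k * k) :=
            Nat.pow_le_pow_right (by omega) (Nat.sub_le _ _)
        _ ≤ (2 ^ ((L + 2) * (c₂ + 1))) ^ (k * k) := Nat.pow_le_pow_left hδn _
        _ = 2 ^ ((L + 2) * (c₂ + 1) * (k * k)) := by rw [← pow_mul]
        _ ≤ 2 ^ ((c₂ + 1) * (L + 2) ^ (2 * c₁ + 3)) := Nat.pow_le_pow_right (by norm_num) hexp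
  -- (3) assemble
  have hB' : B ≤ 2 ^ ((c₂ + 1) * (L + 2) ^ (2 * c₁ + 3) + ((L + 2) ^ (a + a * a) + (L + 2))) := by
    calc B ≤ (δ * n + 1) ^ (k * k - 1) * (s + 2) := hB
      _ ≤ 2 ^ ((c₂ + 1) * (L + 2) ^ (2 * c₁ + 3)) * 2 ^ ((L + 2) ^ (a + a * a) + (L + 2)) :=
          Nat.mul_le_mul hfac hs2
      _ = 2 ^ ((c₂ + 1) * (L + 2) ^ (2 * c₁ + 3) + ((L + 2) ^ (a + a * a) + (L + 2))) := by
          rw [← pow_add]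
  refine hB'.trans (Nat.pow_le_pow_right (by norm_num) ?_)
  have e1 : (c₂ + 1) * (L + 2) ^ (2 * c₁ + 3) ≤ (L + 2) ^ P := by
    calc (c₂ + 1) * (L + 2) ^ (2 * c₁ + 3) ≤ (L + 2) ^ (c₂ + 1) * (L + 2) ^ (2 * c₁ + 3) :=
          Nat.mul_le_mul_right _
            ((Nat.lt_two_pow_self).le.trans (Nat.pow_le_pow_left hM2 (c₂ + 1)))
      _ = (L + 2) ^ (2 * c₁ + c₂ + 4) := by rw [← pow_add]; ring_nf
      _ ≤ (L + 2) ^ P := Nat.pow_le_pow_right hM1 (by omega)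
  have e2 : (L + 2) ^ (a + a * a) ≤ (L + 2) ^ P := Nat.pow_le_pow_right hM1 (by omega)
  have e3 : L + 2 ≤ (L + 2) ^ P := by
    calc L + 2 = (L + 2) ^ 1 := (pow_one _).symm
      _ ≤ (L + 2) ^ P := Nat.pow_le_pow_right hM1 (by omega)
  have e4 : 3 * (L + 2) ^ P ≤ (L + 2) ^ (P + 2) := by
    have h3 : 3 ≤ (L + 2) ^ 2 := by nlinarith
    calc 3 * (L + 2) ^ P = (L + 2) ^ P * 3 := by ring
      _ ≤ (L + 2) ^ P * (L + 2) ^ 2 := Nat.mul_le_mul_left _ h3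
      _ = (L + 2) ^ (P + 2) := by rw [← pow_add]
  have e5 : (L + 2) ^ (P + 2) ≤ (L + (P + 2)) ^ (P + 2) := Nat.pow_le_pow_left (by omega) _
  have e6 : L + (2 * c₁ + c₂ + 4 + a + a * a + 2) = L + (P + 2) := by rw [hP]
  rw [e6]
  omega

end QPBookkeeping

/-! ### Theorem 2.4 -/

/-- **`I(C) ∩ metaVQP` is closed under orbit-span replacement** (the content of the proof of
Thm. 2.4, stated once): for an invariant measure `c`, if `(Δ_n) ∈ I(C) ∩ metaVQP` and each
`Δ'_n` lies in the orbit span `span (GL_{k(n)} · Δ_n)`, then `(Δ'_n) ∈ I(C) ∩ metaVQP` — with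
the same format: `Δ'_n` is homogeneous of the same degree (`isHomogeneous_of_mem_span_orbit`),
vanishes where `Δ_n` must (`eval_formCoeff_eq_zero_of_mem_span_orbit`), and
`cc(Δ'_n) ≤ (δ(n) n + 1)^{k(n)²-1} (cc(Δ_n) + 2)` is again quasi-polynomial in `N(n)`
(`affComplexity_le_of_mem_span_orbit'`, `qp_bookkeeping`).
[cite: BergEtAl2024, Thm. 2.4 (proof), p.10 (PDF p.11)] -/
theorem mem_inter_of_forall_mem_span_orbit {c : (k d : ℕ) → MvPolynomial (Fin k) ℂ → ℕ}
    (hc : IsInvariantMeasure c) {kk : ℕ → ℕ}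
    {Δ Δ' : (n : ℕ) → MvPolynomial (DegIdx (Fin (kk n)) n) ℂ}
    (hI : Δ ∈ vanishingIdealSeq c kk) (hV : Δ ∈ metaVQP kk)
    (hΔ' : ∀ n, Δ' n ∈ Submodule.span ℂ
      (Set.range fun h : GL (Fin (kk n)) ℂ => coordRep (Fin (kk n)) ℂ n h (Δ n))) :
    Δ' ∈ vanishingIdealSeq c kk ∧ Δ' ∈ metaVQP kk := by
  obtain ⟨hkk, δ, hhom, hδ, hcc⟩ := hV
  refine ⟨fun r hr => ?_, hkk, δ, fun n => isHomogeneous_of_mem_span_orbit (hhom n) (hΔ' n), hδ, ?_⟩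
  · obtain ⟨n₀, hn₀⟩ := hI r hr
    exact ⟨n₀, fun n hn f hf =>
      eval_formCoeff_eq_zero_of_mem_span_orbit hc (fun f' hf' => hn₀ n hn f' hf') (hΔ' n) hf⟩
  · obtain ⟨c₁, hc₁⟩ := hkk
    obtain ⟨c₂, hc₂⟩ := hδ
    obtain ⟨a, ha⟩ := hcc
    obtain ⟨A, hA⟩ := qp_bookkeeping c₁ c₂ a
    refine ⟨A, fun n => hA (kk n) n (δ n) (affComplexity (Δ n)) _ (hc₁ n) (hc₂ n) (ha n) ?_⟩
    exact affComplexity_le_of_mem_span_orbit' (hhom n) le_rfl (hΔ' n)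

/-- **Natural proofs can be taken to be highest-weight vectors** (the `⇒` half of Thm. 2.4 in
its sharper highest-weight form, cf. §2.3: "Theorem 1.1 … can be used to study the highest
weight vectors", and Thm. 1.1 (3)): if the class cut out by an invariant measure `c` has algebraic
natural proofs, then there is a not-eventually-zero `(Δ'_n) ∈ I(C) ∩ metaVQP` every member of
which is a highest-weight vector of `k[Sym^n]` (of some weight `χ_n`; `0` counts, being in every
`highestWeightSpace`). Construction as in the printed proof of Thm. 2.4 with the isotypic
projection replaced by a nonzero highest-weight vector of the orbit span `span (GL · Δ_n)`
(`exists_mem_highestWeightSpace_of_stable`); the three memberships are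
`eval_formCoeff_eq_zero_of_mem_span_orbit`, `affComplexity_le_of_mem_span_orbit'` with
`qp_bookkeeping`, and `isHomogeneous_of_mem_span_orbit`.
[cite: BergEtAl2024, Thm. 2.4 (proof) and §2.3, p.8 and p.10 (PDF p.9, p.11)] -/
theorem exists_hwv_naturalProofs {c : (k d : ℕ) → MvPolynomial (Fin k) ℂ → ℕ}
    (hc : IsInvariantMeasure c) (hnat : HasAlgebraicNaturalProofs c) :
    ∃ (kk : ℕ → ℕ) (Δ : (n : ℕ) → MvPolynomial (DegIdx (Fin (kk n)) n) ℂ),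
      Δ ∈ vanishingIdealSeq c kk ∧ Δ ∈ metaVQP kk ∧
        (∀ n, ∃ χ : Weight (Fin (kk n)), Δ n ∈ highestWeightSpace (coordRep (Fin (kk n)) ℂ n) χ) ∧
        ¬ EventuallyZero Δ := by
  obtain ⟨kk, Δ, hI, hVQP, hne⟩ := hnat
  obtain ⟨hkk, δ, hhom, hδ, hcc⟩ := hVQP
  classical
  have key : ∀ n, ∃ Δ' : MvPolynomial (DegIdx (Fin (kk n)) n) ℂ,
      Δ' ∈ Submodule.span ℂ
        (Set.range fun h : GL (Fin (kk n)) ℂ => coordRep (Fin (kk n)) ℂ n h (Δ n)) ∧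
      (∃ χ : Weight (Fin (kk n)), Δ' ∈ highestWeightSpace (coordRep (Fin (kk n)) ℂ n) χ) ∧
      (Δ n ≠ 0 → Δ' ≠ 0) := by
    intro n
    by_cases h0 : Δ n = 0
    · exact ⟨0, Submodule.zero_mem _, ⟨0, Submodule.zero_mem _⟩, fun h => (h h0).elim⟩
    · set M := Submodule.span ℂ
        (Set.range fun h : GL (Fin (kk n)) ℂ => coordRep (Fin (kk n)) ℂ n h (Δ n)) with hM
      have hMstab : ∀ g, M ≤ M.comap (coordRep (Fin (kk n)) ℂ n g) := span_orbit_le_comap (Δ n)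
      obtain ⟨T, -, hTmem⟩ :=
        exists_finset_forall_coordRep_mem_span (Δ n) (hhom n).totalDegree_le
      have hMT : M ≤ Submodule.span ℂ (T : Set (MvPolynomial (DegIdx (Fin (kk n)) n) ℂ)) :=
        Submodule.span_le.mpr (by rintro _ ⟨g, rfl⟩; exact hTmem g)
      haveI : FiniteDimensional ℂ M := Submodule.finiteDimensional_of_le hMT
      have hMne : M ≠ ⊥ := by
        intro hbot
        have hmem : Δ n ∈ M := self_mem_span_orbit (Δ n)
        rw [hbot] at hmem
        exact h0 ((Submodule.mem_bot ℂ).mp hmem)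
      obtain ⟨χ, v, hvM, hv0, hvχ⟩ :=
        exists_mem_highestWeightSpace_of_stable (isRationalRep_coordRep n) M hMstab hMne
      exact ⟨v, hvM, ⟨χ, hvχ⟩, fun _ => hv0⟩
  choose Δ' hΔ'M hΔ'hw hΔ'ne using key
  obtain ⟨hI', hV'⟩ := mem_inter_of_forall_mem_span_orbit hc hI ⟨hkk, δ, hhom, hδ, hcc⟩ hΔ'M
  refine ⟨kk, Δ', hI', hV', hΔ'hw, ?_⟩
  -- not eventually zero
  rintro ⟨n₀, hn₀⟩
  exact hne ⟨n₀, fun n hn => by_contra fun h => hΔ'ne n h (hn₀ n hn)⟩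

/-- **van den Berg–Dutta–Gesmundo–Ikenmeyer–Lysikov 2024, Theorem 2.4 (Main theorem about
algebraic natural proofs) holds**: for the class `C` cut out by an invariant complexity measure
`c`, "`C` has algebraic natural proofs if and only if `I(C) ∩ metaVQP ∩ Isotypic` contains a
sequence that is not eventually zero." The printed proof is followed: one direction is an
inclusion (`thm_2_4_mpr`, statement file); for the other, a witness `(Δ_n)` is replaced by a
nonzero isotypic metapolynomial in the span of `GL_{k(n)} · Δ_n` — here a nonzero highest-weight
vector of that span (`exists_hwv_naturalProofs`), which is isotypic
(`highestWeightSpace_le_hwSubrep`). Discharge of the named fact `BergEtAl2024.thm_2_4`; used BY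
NAME in the `BarrierLever` NP-corpus chain
(`Summits/…/Theorems/BarrierLeverNPCorpusChainBDGIL.lean`).
[cite: BergEtAl2024, Thm. 2.4, p.10 (PDF p.11)] -/
theorem thm_2_4_holds : thm_2_4 := by
  intro c hc
  refine ⟨fun hnat => ?_, fun h => thm_2_4_mpr c h⟩
  obtain ⟨kk, Δ, hI, hVQP, hhw, hne⟩ := exists_hwv_naturalProofs hc hnat
  refine ⟨kk, Δ, hI, hVQP, fun n => ?_, hne⟩
  obtain ⟨χ, hχ⟩ := hhw n
  exact ⟨χ, highestWeightSpace_le_hwSubrep _ χ hχ⟩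

end BergEtAl2024

end Literature.Barriers.ValiantsHypothesis

end
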